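import Literature.AlgebraicGeometry.Motives.HodgeLieWeightOnePlusLineCommutant
import Literature.AlgebraicGeometry.Motives.MumfordTateInvariantsDualForm
import Mathlib.LinearAlgebra.Matrix.BilinearForm
import HarnessLib

/-!
# Weight one, type-III position: `8 ∣ dim_ℚ V` — the symplectic form on `W₁₁ = P P′ V_ℂ`

Family `hodge`, layer `Literature/AlgebraicGeometry/Motives`; THEOREMS ONLY (no definition, no named fact; D-0026).
Sequel of `HodgeLieWeightOnePlusLineCommutant` for the cell `pub-hodgecm2` (COR-CM) lane MT-RANK-SEVEN-TYPEIII, seat `b27`.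

SETTING (type III): `H` polarized by `ψ`, weight `1`, graded basis `e`, Hodge projector `P`, plus-line blocks `E, F`
(`E F = αP`, `F E = α(1 − P)`), and the standard `sl₂`-triple `(h′, e′, f′)` of `𝔨` (`e′f′ = P′ = ½(1 + h′)`, `f′e′ = 1 − P′`,
`e′² = 0`), commuting with `P, E, F`.  Then `V_ℂ = W₁₁ ⊕ W₁₀ ⊕ W₀₁ ⊕ W₀₀` for the commuting projectors `P, P′`, and
`ω(m, m′) = ψ_ℂ(m, F f′ m′)` is a NON-DEGENERATE ALTERNATING form on `W₁₁ = range (P′P)`: `F` and `f′` are `ψ_ℂ`-skew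
elements of `𝔥_ℂ` (`formBaseChange_skew_of_mem_hodgeLieC`), `ψ_ℂ` is alternating (odd weight), `range P = F¹` and `range P′`
are `ψ_ℂ`-isotropic, and `F f′ : W₁₁ ⥲ W₀₀` (inverse `α⁻¹ E e′`).  Hence `dim W₁₁` is even (a non-degenerate skew form in odd
dimension has `det G = det Gᵀ = −det G`), and with `4 · dim W₁₁ = dim_ℚ V` (`four_mul_finrank_range_eq`):

* **`even_finrank_of_nondegenerate_of_skew`** — pure linear algebra: a non-degenerate skew bilinear form lives in even
  dimension.
* **`eight_dvd_finrank_of_plusLine`** — `8 ∣ dim_ℚ V` (`dim X ≡ 0 mod 4` for the abelian variety).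
* **`finrank_endAlg_typeThree_of_plusLine`** — SUMMARY under the standing hypotheses only (`𝔷 = 0`, `Lie Hg` `ℚ`-simple of
  dimension `6`, plus-line position): `dim_ℚ V = 8k`, `dim_ℚ End_Hdg = 4k²`, `Z(End_Hdg) = ℚ`.

## References

* [MoonenZarhin1999LowDim] B. Moonen, Yu. Zarhin, *Hodge classes on abelian varieties of low dimension*, Math. Ann. 315
  (1999), §2 (2.3) Type III.
* [MumfordAV1970] D. Mumford, *Abelian Varieties* (1970), §21 (Albert's classification, Type III: `4 ∣ 2g/… `).
* [HoffmanKunze1971LinearAlgebra] K. Hoffman, R. Kunze, *Linear Algebra* (1971), §10.3 (skew-symmetric forms have even rank).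
-/

noncomputable section

open scoped TensorProduct

namespace Literature.AlgebraicGeometry.Motives

universe u

namespace HodgeStructure

open ProjectorBlocks Literature.RepresentationTheory.GeneralLinear

variable {V : Type u} [AddCommGroup V] [Module ℚ V] [Module.Finite ℚ V] [HodgeTensorFacts.{u, u}] {n : ℤ}
  {S : Type u} [Fintype S] [DecidableEq S] {deg : S → ℤ}

/-! ## §1 A non-degenerate skew form lives in even dimension -/

omit [HodgeTensorFacts.{u, u}] in
/-- **A non-degenerate skew-symmetric bilinear form on a finite-dimensional space over a field of characteristic `0` has
even dimension**: its Gram matrix `G` satisfies `Gᵀ = −G`, so `det G = (−1)^{dim} det G`.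
[cite: HoffmanKunze1971LinearAlgebra, §10.3] -/
theorem even_finrank_of_nondegenerate_of_skew {K M : Type*} [Field K] [CharZero K] [AddCommGroup M] [Module K M]
    [FiniteDimensional K M] (B : LinearMap.BilinForm K M) (hskew : ∀ x y, B x y = -B y x) (hB : B.Nondegenerate) :
    Even (Module.finrank K M) := by
  classical
  by_contra hodd
  rw [Nat.not_even_iff_odd] at hodd
  obtain ⟨b⟩ : Nonempty (Module.Basis (Fin (Module.finrank K M)) K M) := ⟨Module.finBasis K M⟩
  apply (LinearMap.BilinForm.nondegenerate_iff_det_ne_zero b).1 hB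
  obtain ⟨G, hG⟩ : ∃ G : Matrix (Fin (Module.finrank K M)) (Fin (Module.finrank K M)) K,
      G = LinearMap.BilinForm.toMatrix b B := ⟨_, rfl⟩
  have hGt : G.transpose = -G := by
    ext i j
    rw [Matrix.transpose_apply, Matrix.neg_apply, hG, LinearMap.BilinForm.toMatrix_apply,
      LinearMap.BilinForm.toMatrix_apply, hskew]
  have h1 : G.det = -G.det := by
    conv_lhs => rw [← Matrix.det_transpose, hGt, Matrix.det_neg, Fintype.card_fin, hodd.neg_one_pow, neg_one_mul]
  rw [← hG]
  exact add_self_eq_zero.1 (eq_neg_iff_add_eq_zero.1 h1)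

/-! ## §2 `8 ∣ dim_ℚ V` -/

/-- **`8 ∣ dim_ℚ V` in the type-III position** (weight one, `𝔷 = 0`, plus-line blocks `E, F`, and the standard `sl₂`-triple
`(h′, e′, f′)` of `𝔨`): `ω(m, m′) = ψ_ℂ(m, F f′ m′)` is a non-degenerate alternating form on `W₁₁ = range (P′P)`,
`P′ = ½(1 + h′) = e′f′`, so `dim W₁₁ = dim_ℚ V / 4` is even. [cite: MoonenZarhin1999LowDim, §2 (2.3)]
[cite: MumfordAV1970, §21] -/
theorem eight_dvd_finrank_of_plusLine (H : HodgeStructure V n) (ψ : H.Polarization) (hn : n = 1)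
    (e : Module.Basis S ℂ (ℂ ⊗[ℚ] V)) (hF : ∀ a, H.F a = Submodule.span ℂ (e '' {σ | a ≤ deg σ}))
    (hFc : ∀ a, complexConj (H.F a) = Submodule.span ℂ (e '' {σ | deg σ ≤ n - a}))
    (hdeg : ∀ σ, deg σ = 0 ∨ deg σ = 1) {X : Module.End ℚ V} (hX : X ∈ H.hodgeLie) (hXE : X ∉ H.endAlg)
    (hplus : ∀ Y ∈ H.hodgeLieC, ∃ c : ℂ,
      gradingEnd e deg * Y * (1 - gradingEnd e deg) = c • (gradingEnd e deg * X.baseChange ℂ * (1 - gradingEnd e deg)))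
    (hminus : ∀ Y ∈ H.hodgeLieC, ∃ c : ℂ,
      (1 - gradingEnd e deg) * Y * gradingEnd e deg = c • ((1 - gradingEnd e deg) * X.baseChange ℂ * gradingEnd e deg))
    (hz : H.hodgeLie ⊓ Subalgebra.toSubmodule H.endAlg = ⊥) {h' e' f' : Module.End ℂ (ℂ ⊗[ℚ] V)}
    (hh' : h' ∈ H.hodgeLieC ∧ h' * gradingEnd e deg = gradingEnd e deg * h' ∧
      h' * (gradingEnd e deg * X.baseChange ℂ * (1 - gradingEnd e deg)) =
        (gradingEnd e deg * X.baseChange ℂ * (1 - gradingEnd e deg)) * h')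
    (he' : e' ∈ H.hodgeLieC ∧ e' * gradingEnd e deg = gradingEnd e deg * e' ∧
      e' * (gradingEnd e deg * X.baseChange ℂ * (1 - gradingEnd e deg)) =
        (gradingEnd e deg * X.baseChange ℂ * (1 - gradingEnd e deg)) * e')
    (hf' : f' ∈ H.hodgeLieC ∧ f' * gradingEnd e deg = gradingEnd e deg * f' ∧
      f' * (gradingEnd e deg * X.baseChange ℂ * (1 - gradingEnd e deg)) =
        (gradingEnd e deg * X.baseChange ℂ * (1 - gradingEnd e deg)) * f')
    (hstd : h' * h' = 1 ∧ e' * e' = 0 ∧ f' * f' = 0 ∧ e' * f' = (2 : ℂ)⁻¹ • (1 + h') ∧ f' * e' = (2 : ℂ)⁻¹ • (1 - h') ∧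
      h' * e' = e' ∧ e' * h' = -e' ∧ h' * f' = -f' ∧ f' * h' = f') :
    8 ∣ Module.finrank ℚ V := by
  classical
  subst hn
  obtain ⟨-, hhP, hhE⟩ := hh'
  obtain ⟨heM, heP, heE⟩ := he'
  obtain ⟨hfM, hfP, hfE⟩ := hf'
  obtain ⟨hhh, hee, -, hef', hfe', hhe', -, -, -⟩ := hstd
  have hef : e' * f' - f' * e' = h' := by
    rw [hef', hfe']
    module
  obtain ⟨α, hα, hEF, hFE, -⟩ :=
    projE_mul_projF_eq_smul_of_plusLine_of_center_eq_bot H ψ rfl e hF hFc hdeg hX hXE hplus hminus hz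
  have hPP : gradingEnd e deg * gradingEnd e deg = gradingEnd e deg := gradingEnd_mul_gradingEnd_of_deg e hdeg
  obtain ⟨-, hFM⟩ := projE_mem_hodgeLieC H e hF hFc hdeg (H.baseChange_mem_hodgeLieC hX)
  obtain ⟨hfF, -⟩ := commute_of_plusLine H ψ rfl e hF hFc hdeg hX hXE hplus hminus hz hfP hfE
  have hrk := four_mul_finrank_range_eq hα hPP hEF hFE hhP heP hef hhh
  -- `range P ⊆ F¹`, which is `ψ_ℂ`-isotropic
  have hPF1 : ∀ z, gradingEnd e deg z ∈ H.F 1 := fun z => by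
    rw [hF 1]
    exact Submodule.span_mono (Set.image_mono fun σ (h : deg σ = 1) => h.ge) (gradingEnd_apply_mem_span_one e hdeg z)
  have h111 : (1 : ℤ) + 1 - 1 = 1 := by norm_num
  have hiso : ∀ z z', ψ.form.baseChange ℂ (gradingEnd e deg z) (gradingEnd e deg z') = 0 := fun z z' =>
    ψ.form_apply_eq_zero 1 _ (hPF1 z) _ (by rw [h111]; exact hPF1 z')
  set P := gradingEnd e deg with hP
  set E := P * X.baseChange ℂ * (1 - P) with hEdef
  set F := (1 - P) * X.baseChange ℂ * P with hFdef
  have hPE : P * E = E := by rw [hEdef, ← mul_assoc, ← mul_assoc, hPP]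
  clear_value P E F
  -- skewness of `F`, `f′`, `e′` and of `ψ_ℂ`
  have hskF : ∀ x y, ψ.form.baseChange ℂ x (F y) = -ψ.form.baseChange ℂ (F x) y := fun x y => by
    rw [formBaseChange_skew_of_mem_hodgeLieC ψ hFM, neg_neg]
  have hskf : ∀ x y, ψ.form.baseChange ℂ x (f' y) = -ψ.form.baseChange ℂ (f' x) y := fun x y => by
    rw [formBaseChange_skew_of_mem_hodgeLieC ψ hfM, neg_neg]
  have hske : ∀ x y, ψ.form.baseChange ℂ (e' x) y = -ψ.form.baseChange ℂ x (e' y) := fun x y =>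
    formBaseChange_skew_of_mem_hodgeLieC ψ heM x y
  have hswap : ∀ x y, ψ.form.baseChange ℂ y x = -ψ.form.baseChange ℂ x y :=
    form_baseChange_swap_of_odd H odd_one ψ
  -- `P′ = e′f′`: idempotent, commuting with `P` and `E`, `P′e′ = e′`, `f′e′ = 1 − P′`, `range P′` isotropic
  obtain ⟨P', hP'⟩ : ∃ P' : Module.End ℂ (ℂ ⊗[ℚ] V), P' = (2 : ℂ)⁻¹ • (1 + h') := ⟨_, rfl⟩
  rw [← hP'] at hrk hef'
  have hfe1 : f' * e' = 1 - P' := by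
    rw [hP', hfe']
    module
  have hP'P : P' * P = P * P' := by rw [hP', smul_mul_assoc, mul_smul_comm, add_mul, mul_add, one_mul, mul_one, hhP]
  have hP'E : P' * E = E * P' := by rw [hP', smul_mul_assoc, mul_smul_comm, add_mul, mul_add, one_mul, mul_one, hhE]
  have hP'e : P' * e' = e' := by
    rw [hP', smul_mul_assoc, add_mul, one_mul, hhe', ← two_smul ℂ e', smul_smul]
    norm_num
  have hsq : (1 + h') * (1 + h') = (2 : ℂ) • (1 + h') := by
    rw [add_mul, one_mul, mul_add, mul_one, hhh, two_smul]
    abel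
  have hP'P' : P' * P' = P' := by
    rw [hP', smul_mul_assoc, mul_smul_comm, smul_smul, hsq, smul_smul]
    norm_num
  have hPPP : P * (P' * P) = P' * P := by rw [← mul_assoc, ← hP'P, mul_assoc, hPP]
  have hP'PP : P' * (P' * P) = P' * P := by rw [← mul_assoc, hP'P']
  have hisoP' : ∀ z z', ψ.form.baseChange ℂ (P' z) (P' z') = 0 := fun z z' => by
    rw [← hef', Module.End.mul_apply, Module.End.mul_apply, hske, ← Module.End.mul_apply e' e', hee,
      LinearMap.zero_apply, map_zero, neg_zero]
  -- the form `ω(m, m′) = ψ_ℂ(m, F f′ m′)` on `W₁₁ = range (P′P)`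
  obtain ⟨ω, hω⟩ : ∃ ω : LinearMap.BilinForm ℂ (LinearMap.range (P' * P)), ∀ m m' : LinearMap.range (P' * P),
      ω m m' = ψ.form.baseChange ℂ (m : ℂ ⊗[ℚ] V) ((F * f') (m' : ℂ ⊗[ℚ] V)) :=
    ⟨(ψ.form.baseChange ℂ).comp (LinearMap.range (P' * P)).subtype ((F * f') ∘ₗ (LinearMap.range (P' * P)).subtype),
      fun m m' => by rw [LinearMap.BilinForm.comp_apply]; rfl⟩
  have hωskew : ∀ m m' : LinearMap.range (P' * P), ω m m' = -ω m' m := by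
    intro m m'
    rw [hω, hω, Module.End.mul_apply, hskF, hskf, neg_neg, ← Module.End.mul_apply f' F, hfF,
      hswap (m' : ℂ ⊗[ℚ] V) ((F * f') (m : ℂ ⊗[ℚ] V))]
  have hL : ω.SeparatingLeft := by
    intro m hm
    obtain ⟨x, hx⟩ := m
    apply Subtype.ext
    change x = 0
    obtain ⟨u, hu⟩ := LinearMap.mem_range.1 hx
    have hPx : P x = x := by rw [← hu, ← Module.End.mul_apply, hPPP]
    have hP'x : P' x = x := by rw [← hu, ← Module.End.mul_apply, hP'PP]
    refine ψ.eq_zero_of_forall_form_eq_zero fun y => ?_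
    -- the test vector `m′ = α⁻¹ E e′ y ∈ W₁₁`, with `F f′ m′ = (1 − P)(1 − P′) y`
    have hm'mem : E (e' y) ∈ LinearMap.range (P' * P) := by
      refine ⟨E (e' y), ?_⟩
      rw [Module.End.mul_apply, ← Module.End.mul_apply P E, hPE, ← Module.End.mul_apply P' E, hP'E, Module.End.mul_apply,
        ← Module.End.mul_apply P' e', hP'e]
    have h0 := hm ⟨(α⁻¹ : ℂ) • E (e' y), Submodule.smul_mem _ _ hm'mem⟩
    rw [hω] at h0
    change ψ.form.baseChange ℂ x ((F * f') ((α⁻¹ : ℂ) • E (e' y))) = 0 at h0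
    have hkey : (F * f') (E (e' y)) = α • ((1 - P) ((1 - P') y)) := by
      rw [Module.End.mul_apply, ← Module.End.mul_apply f' E, hfE, Module.End.mul_apply, ← Module.End.mul_apply F E, hFE,
        ← Module.End.mul_apply f' e', hfe1, LinearMap.smul_apply]
    rw [map_smul, map_smul, hkey, map_smul, smul_eq_mul, smul_eq_mul, ← mul_assoc, inv_mul_cancel₀ hα, one_mul] at h0
    -- `y = P(y − P′y) + P′y + (1 − P)(1 − P′)y`, the first two summands being `ψ_ℂ`-orthogonal to `x = Px = P′x`
    have h1 : ψ.form.baseChange ℂ x (P (y - P' y)) = 0 := by rw [← hPx]; exact hiso x (y - P' y)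
    have h2 : ψ.form.baseChange ℂ x (P' y) = 0 := by rw [← hP'x]; exact hisoP' x y
    have hdec : y = P (y - P' y) + P' y + (1 - P) ((1 - P') y) := by
      simp only [LinearMap.sub_apply, Module.End.one_apply, map_sub]
      abel
    rw [hdec, map_add, map_add, h1, h2, h0, add_zero, add_zero]
  have hR : ω.SeparatingRight := fun m' hm' => hL m' fun m => by rw [hωskew, hm' m, neg_zero]
  obtain ⟨j, hj⟩ := even_finrank_of_nondegenerate_of_skew ω hωskew ⟨hL, hR⟩
  exact ⟨j, by rw [← hrk, hj]; ring⟩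

/-! ## §3 Summary of the type-III position -/

/-- **The type-III position, summary.**  For a weight-one polarizable Hodge structure `(V, H, ψ)` with `𝔷 = Lie Hg ∩ End_Hdg
= 0`, `Lie Hg` SIMPLE over `ℚ` of dimension `6`, and a Hodge-graded basis in the plus-line position `(dim 𝔤⁺, dim 𝔤⁻) =
(1, 1)`: `dim_ℚ V = 8k`, `dim_ℚ End_Hdg(V) = 4k² = (dim_ℚ V / 4)²`, and the centre of `End_Hdg(V)` is `ℚ` — the invariants
of an abelian variety of dimension `4k` isogenous to a power of a simple abelian variety of type III in Albert's
classification (definite quaternion algebra over `ℚ`), Moonen–Zarhin (2.3). [cite: MoonenZarhin1999LowDim, §2 (2.3)]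
[cite: MumfordAV1970, §21] [cite: Deligne1982HodgeCycles, I §3 (3.4–3.6)] -/
theorem finrank_endAlg_typeThree_of_plusLine (H : HodgeStructure V n) (ψ : H.Polarization) (hn : n = 1)
    (e : Module.Basis S ℂ (ℂ ⊗[ℚ] V)) (hF : ∀ a, H.F a = Submodule.span ℂ (e '' {σ | a ≤ deg σ}))
    (hFc : ∀ a, complexConj (H.F a) = Submodule.span ℂ (e '' {σ | deg σ ≤ n - a}))
    (hdeg : ∀ σ, deg σ = 0 ∨ deg σ = 1) {X : Module.End ℚ V} (hX : X ∈ H.hodgeLie) (hXE : X ∉ H.endAlg)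
    (hplus : ∀ Y ∈ H.hodgeLieC, ∃ c : ℂ,
      gradingEnd e deg * Y * (1 - gradingEnd e deg) = c • (gradingEnd e deg * X.baseChange ℂ * (1 - gradingEnd e deg)))
    (hminus : ∀ Y ∈ H.hodgeLieC, ∃ c : ℂ,
      (1 - gradingEnd e deg) * Y * gradingEnd e deg = c • ((1 - gradingEnd e deg) * X.baseChange ℂ * gradingEnd e deg))
    (hz : H.hodgeLie ⊓ Subalgebra.toSubmodule H.endAlg = ⊥)
    (hsimple : letI : LieRing (Module.End ℚ V) := LieRing.ofAssociativeRing
      ∀ 𝔏 : LieSubalgebra ℚ (Module.End ℚ V), 𝔏.toSubmodule = H.hodgeLie → LieAlgebra.IsSimple ℚ 𝔏)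
    (h6 : Module.finrank ℚ H.hodgeLie = 6) :
    ∃ k : ℕ, Module.finrank ℚ V = 8 * k ∧ Module.finrank ℚ H.endAlg = 4 * k ^ 2 ∧
      ∀ a ∈ H.endAlg, (∀ b ∈ H.endAlg, b * a = a * b) → ∃ q : ℚ, a = q • 1 := by
  obtain ⟨h', e', f', hh', he', hf', hhe, hhf, hef, hspan⟩ :=
    exists_sl2Triple_centraliser_of_plusLine H ψ hn e hF hFc hdeg hX hXE hplus hminus hz h6
  obtain ⟨htrh, htref⟩ :=
    trace_sl2Triple_of_plusLine H ψ hn e hF hFc hdeg hX hXE hplus hminus hz hsimple h6 hh' he' hf' hhe hhf hef hspan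
  have hstd := standardForm_of_plusLine H ψ hn e hF hFc hdeg hX hXE hplus hminus hz hsimple hh' he' hf' hhe hhf hef hspan
    htrh htref
  obtain ⟨k, hk, hE, hcen⟩ := finrank_endAlg_of_plusLine H ψ hn e hF hFc hdeg hX hXE hplus hminus hz hh' he' hf' hspan hstd
  obtain ⟨j, hj⟩ := eight_dvd_finrank_of_plusLine H ψ hn e hF hFc hdeg hX hXE hplus hminus hz hh' he' hf' hstd
  have hkj : k = 2 * j := by omega
  exact ⟨j, hj, by rw [hE, hkj]; ring, hcen⟩

end HodgeStructure

end Literature.AlgebraicGeometry.Motives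

end
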